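import Summits.QuantumFields.BalabanUV.Beta.SecondOrderStepTransport
import Summits.QuantumFields.BalabanUV.Beta.ChartConjugationReflection
import Summits.QuantumFields.BalabanUV.Beta.KernelWardCoarseExchange
import Summits.QuantumFields.BalabanUV.Beta.KernelWardResponse
import Summits.QuantumFields.BalabanUV.Beta.TameKernelCalculus
import Summits.QuantumFields.BalabanUV.Beta.BubbleParity
import Summits.QuantumFields.BalabanUV.Beta.SymCorrectorW2Gauge

/-!
# `BalabanUV.Gaps.D1PinnedFirstOrderBilinear` — cell pub-balaban-gaps, row (D1), seat g1-p1: THE FIRST-ORDER PAIR `(S, M)` ENTERS an2's SECOND-ORDER OBJECTS BILINEARLY, AND ALONG A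
# QUADRATIC PAIR PATH `t ↦ x(t) = (t²A + tB, t²P + tQ)` (the shape of the pinned family's first-order tables on a colour ray `t ↦ t·c⃗`) THE FIRST-ORDER SOURCE OF an2's RECURSION IS
# AN EXPLICIT QUARTIC IN `t` WITH NO TERMS OF DEGREE `< 2` — the one-level algebra of the degree count «`φ` is a quartic along every colour ray» (census row 72b)

HONEST FRAMING (cell rule, page 1 of everything): [folklore] kernel algebra BY NAME over the β sub-cell's ∕ an2's ∕ gan24's letters — `SecondOrderResponse.dM ∕ K2OfK ∕ W2OfK_apply ∕ W2SymOfK`,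
`BalabanStepW2.K3OfK`, `ChartConjugationReflection.vertexOfK_add ∕ summable_abs_colH ∕ abs_le_of_locStencil`, `KernelWardCoarseExchange.vertexOfM_add`, `KernelWardMColumn.summable_abs_colM`,
`SecondOrderStepTransport.loc_K2OfK`, `SecondOrderTransport.K2OfK_eq ∕ loc_dM ∕ dM_smul_kernel ∕ vertexOfK_smul_family ∕ vertexOfM_smul_family`, `BubbleParity.spr_of_decays`, `SymCorrectorW2Gauge.decays_of_loc`,
`TameKernelCalculus` (`Spr ∕ Loc ∕ Tame`, `comp_add_right_tame ∕ comp_add_left_tame`, `Spr.comp_loc`, `Loc.smul`), `KernelReflection.comp_smul_left ∕ _right`, `KernelWard.bdd_of_biLoc`; generic decaying `K`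
and tables certified by `LocStencil` ∕ `VertexFamily` (for the pinned family: an4's `decays_KInvStep`, an2's `locStencil_Spure ∕ vertexFamily_M1` — not instantiated here); NOTHING of Bałaban's asserted;
no value computed; (D1) NOT discharged; 0∕4 row-D1 binders; NOT `BetaPertH`, NOT continuum, NOT Clay.  HONEST DEPENDENCY (b2b cell, verbatim): «continuum YM on T⁴ ⇐ BetaPertH ∧ nine spine
estimates (0/9 proved); BetaPertH ⇐ (D1) ∧ (D4) ∧ CAP+tail; G-an2-4 gates asym, D1 and NE2/3/4.»

CONTENT (all [folklore]; no `def`, no `def … : Prop`, 0 sorry): §1 `vertexOfK_add_kernel`, `vertexOfM_add_kernel`, `dM_add_kernel` (the KERNEL slot of the operator derivative is additive);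
§2 **`dM_add_pair`**, `sandwich_add`, **`K2OfK_add_pair`** (additivity in the first-order pair); §3 **`dM_K2OfK_add_pair`** — `D(x₁ + x₂) = D₁₁ + D₁₂ + D₂₁ + D₂₂`, `D_ik := dM (K2OfK K N S_i M_i b′) N S_k M_k b`;
§4 `prod_add_add`, **`K3OfK_pure_add_pair`** (the `W`-free part of `K3OfK` over a sum of two pairs = the four mixed products); §5 certificates — `bdd_of_locCert ∕ bdd_of_vfCert ∕ common_bound`,
**`loc_dM_of_certs`**, `decays_K2OfK_of_certs`, `certs_zero`; §6 THE PATH: **`dM_path`** ∕ `dM_path'` (`dM K N x(t) = t²•dM K N A P + t•dM K N B Q`), **`K2OfK_path`**, **`dM_K2OfK_path`**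
(`D(x(t)) = t⁴•D_AA + t³•(D_AB + D_BA) + t²•D_BB`), **`K3OfK_pure_path`** (the `W`-free part of `K3OfK K N x(t) W` `= −[t⁴•X₄ + t³•X₃ + t²•X₂]`, explicit products), **`W2SymOfK_path`**
(`W2SymOfK K N x(t) S₂ M₂ = W2SymOfK K N 0 0 S₂ M₂ + ½•[t⁴•E₄ + t³•E₃ + t²•E₂]`).  READING: every first-order datum of member `j+1` of an2's `T2Of` is a polynomial of degree ≤ 4 in the ray
parameter with NO linear term; the tower induction and the pinned consequences are the sibling file `Gaps/D1PinnedColourRayQuartic`.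

Provenance: cell pub-balaban-gaps, seat g1-p1 GEN 10 (§1–§4, prover-pub-balaban-gaps-g1-p1-g10-0) and GEN 11 (§5–§6, prover-pub-balaban-gaps-g1-p1-g11-0), 2026-08-24; imports built
modules only; no existing file touched.
-/

noncomputable section

open Finset
open scoped BigOperators
open Literature.MathematicalPhysics.QuantumFieldTheory Balaban1983to89 Balaban1983to89.Beta
open ExpKernelCalculus (MKer Decays BiLoc VertexFamily comp)
open OneStepResolventKernel (Fib wsum LocStencil biLoc_mono)
open OneStepKernelFamily (vertexOfK colH)
open SecondOrderResponse (dM K2OfK vertexOfM colM W2SymOfK W2OfK W2OfK_apply)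
open BalabanStepW2 (K3OfK)
open InterLevelTransport (cwsum cwsum_apply)
open Summit.QuantumFields.BalabanUV.Beta.TameKernelCalculus (Spr Loc Tame comp_add_right_tame comp_add_left_tame)
open Summit.QuantumFields.BalabanUV.Beta.ChartConjugationReflection (vertexOfK_add summable_abs_colH abs_le_of_locStencil)
open Summit.QuantumFields.BalabanUV.Beta.KernelWardCoarseExchange (vertexOfM_add)
open Summit.QuantumFields.BalabanUV.Beta.KernelWardMColumn (summable_abs_colM)
open Summit.QuantumFields.BalabanUV.Beta.SecondOrderStepTransport (loc_K2OfK)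
open Summit.QuantumFields.BalabanUV.Beta.SecondOrderTransport (K2OfK_eq loc_dM dM_smul_kernel vertexOfK_smul_family vertexOfM_smul_family)
open Summit.QuantumFields.BalabanUV.Beta.BubbleParity (spr_of_decays)
open Summit.QuantumFields.BalabanUV.Beta.SymCorrectorW2Gauge (decays_of_loc)

namespace Summit.QuantumFields.BalabanUV.Gaps.D1PinnedFirstOrderBilinear

variable {d : ℕ} {N : ℕ} [NeZero N]

/-! ## §1 The kernel slot of the operator derivative is additive -/

omit [NeZero N] in
/-- [folklore] The field-column vertex is additive in its KERNEL for decaying kernels and a bounded stencil family. -/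
theorem vertexOfK_add_kernel {X Y : MKer (d + 1) (Fib d)} (hX : ∃ δ C : ℝ, 0 < δ ∧ 0 ≤ C ∧ Decays X C δ) (hY : ∃ δ C : ℝ, 0 < δ ∧ 0 ≤ C ∧ Decays Y C δ)
    {S : Fin (d + 1) → (Fin (d + 1) → ℤ) → MKer (d + 1) (Fib d)} {B : ℝ} (hS : ∀ κ' u x z a b, |S κ' u x z a b| ≤ B)
    (μ : Fin (d + 1)) (y : Fin (d + 1) → ℤ) :
    vertexOfK (X + Y) N S μ y = vertexOfK X N S μ y + vertexOfK Y N S μ y := by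
  funext x z a b
  simp only [OneStepKernelFamily.vertexOfK, OneStepResolventKernel.wsum, Pi.add_apply]
  rw [← Finset.sum_add_distrib]
  refine Finset.sum_congr rfl fun κ' _ => ?_
  have hs : ∀ {Z : MKer (d + 1) (Fib d)}, (∃ δ C : ℝ, 0 < δ ∧ 0 ≤ C ∧ Decays Z C δ) → Summable fun u => colH Z N μ y κ' u * S κ' u x z a b := by
    intro Z hZ
    refine Summable.of_norm_bounded ((summable_abs_colH (N := N) hZ μ y κ').mul_right B) fun u => ?_
    rw [Real.norm_eq_abs, abs_mul]
    exact mul_le_mul_of_nonneg_left (hS κ' u x z a b) (abs_nonneg _)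
  rw [← (hs hX).tsum_add (hs hY)]
  refine tsum_congr fun u => ?_
  simp only [OneStepKernelFamily.colH, Pi.add_apply]
  ring

/-- [folklore] The multiplier-column vertex is additive in its KERNEL for decaying kernels and a bounded table. -/
theorem vertexOfM_add_kernel {X Y : MKer (d + 1) (Fib d)} (hX : ∃ δ C : ℝ, 0 < δ ∧ 0 ≤ C ∧ Decays X C δ) (hY : ∃ δ C : ℝ, 0 < δ ∧ 0 ≤ C ∧ Decays Y C δ)
    {M : Fin (d + 1) → (Fin (d + 1) → ℤ) → MKer (d + 1) (Fib d)} {B : ℝ} (hM : ∀ ρ w x z a b, |M ρ w x z a b| ≤ B)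
    (μ : Fin (d + 1)) (y : Fin (d + 1) → ℤ) :
    vertexOfM (X + Y) N M μ y = vertexOfM X N M μ y + vertexOfM Y N M μ y := by
  funext x z a b
  simp only [SecondOrderResponse.vertexOfM, cwsum_apply, Pi.add_apply]
  rw [← Finset.sum_add_distrib]
  refine Finset.sum_congr rfl fun ρ _ => ?_
  have hs : ∀ {Z : MKer (d + 1) (Fib d)}, (∃ δ C : ℝ, 0 < δ ∧ 0 ≤ C ∧ Decays Z C δ) → Summable fun w => colM Z N μ y ρ w * M ρ w x z a b := by
    intro Z hZ
    refine Summable.of_norm_bounded ((summable_abs_colM (N := N) hZ μ y ρ).mul_right B) fun w => ?_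
    rw [Real.norm_eq_abs, abs_mul]
    exact mul_le_mul_of_nonneg_left (hM ρ w x z a b) (abs_nonneg _)
  rw [← (hs hX).tsum_add (hs hY)]
  refine tsum_congr fun w => ?_
  simp only [SecondOrderResponse.colM, Pi.add_apply]
  ring

/-- [folklore] **THE KERNEL SLOT OF THE OPERATOR DERIVATIVE IS ADDITIVE**: `dM (X + Y) N S M b = dM X N S M b + dM Y N S M b` (decaying `X, Y`; bounded tables). -/
theorem dM_add_kernel {X Y : MKer (d + 1) (Fib d)} (hX : ∃ δ C : ℝ, 0 < δ ∧ 0 ≤ C ∧ Decays X C δ) (hY : ∃ δ C : ℝ, 0 < δ ∧ 0 ≤ C ∧ Decays Y C δ)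
    {S M : Fin (d + 1) → (Fin (d + 1) → ℤ) → MKer (d + 1) (Fib d)} {B : ℝ} (hS : ∀ κ' u x z a b, |S κ' u x z a b| ≤ B) (hM : ∀ ρ w x z a b, |M ρ w x z a b| ≤ B)
    (μ : Fin (d + 1)) (y : Fin (d + 1) → ℤ) :
    dM (X + Y) N S M μ y = dM X N S M μ y + dM Y N S M μ y := by
  unfold SecondOrderResponse.dM
  rw [vertexOfK_add_kernel hX hY hS, vertexOfM_add_kernel hX hY hM]
  abel

/-! ## §2 `dM` and `K2OfK` are additive in the first-order pair -/

/-- [folklore] **THE OPERATOR DERIVATIVE IS ADDITIVE IN THE FIRST-ORDER PAIR**: `dM K N (S₁ + S₂) (M₁ + M₂) b = dM K N S₁ M₁ b + dM K N S₂ M₂ b` (decaying `K`, bounded tables;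
`ChartConjugationReflection.vertexOfK_add`, `KernelWardCoarseExchange.vertexOfM_add`). -/
theorem dM_add_pair {K : MKer (d + 1) (Fib d)} (hK : ∃ δ C : ℝ, 0 < δ ∧ 0 ≤ C ∧ Decays K C δ)
    {S₁ S₂ M₁ M₂ : Fin (d + 1) → (Fin (d + 1) → ℤ) → MKer (d + 1) (Fib d)} {B : ℝ}
    (hS₁ : ∀ κ' u x z a b, |S₁ κ' u x z a b| ≤ B) (hS₂ : ∀ κ' u x z a b, |S₂ κ' u x z a b| ≤ B)
    (hM₁ : ∀ ρ w x z a b, |M₁ ρ w x z a b| ≤ B) (hM₂ : ∀ ρ w x z a b, |M₂ ρ w x z a b| ≤ B)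
    (μ : Fin (d + 1)) (y : Fin (d + 1) → ℤ) :
    dM K N (S₁ + S₂) (M₁ + M₂) μ y = dM K N S₁ M₁ μ y + dM K N S₂ M₂ μ y := by
  unfold SecondOrderResponse.dM
  rw [show S₁ + S₂ = fun κ u => S₁ κ u + S₂ κ u from rfl, show M₁ + M₂ = fun ρ w => M₁ ρ w + M₂ ρ w from rfl,
    vertexOfK_add (N := N) hK hS₁ hS₂ μ y, vertexOfM_add (N := N) hK hM₁ hM₂ μ y]
  abel

/-- [folklore] The two-sided sandwich by a spread kernel is additive on localised kernels (`comp_add_right_tame`, `comp_add_left_tame`). -/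
theorem sandwich_add {K D₁ D₂ : MKer (d + 1) (Fib d)} (hKs : Spr K) (h₁ : Loc D₁) (h₂ : Loc D₂) :
    comp (comp K (D₁ + D₂)) K = comp (comp K D₁) K + comp (comp K D₂) K := by
  rw [comp_add_right_tame hKs.tame h₁.tame h₂.tame, comp_add_left_tame (hKs.comp_loc h₁).tame (hKs.comp_loc h₂).tame hKs.tame]

/-- [folklore] **THE DERIVATIVE OF THE INVERSE IS ADDITIVE IN THE FIRST-ORDER PAIR**: `K2OfK K N (S₁ + S₂) (M₁ + M₂) b′ = K2OfK K N S₁ M₁ b′ + K2OfK K N S₂ M₂ b′`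
(decaying `K`, bounded tables, localised `dM K N S_i M_i b′`). -/
theorem K2OfK_add_pair {K : MKer (d + 1) (Fib d)} (hK : ∃ δ C : ℝ, 0 < δ ∧ 0 ≤ C ∧ Decays K C δ)
    {S₁ S₂ M₁ M₂ : Fin (d + 1) → (Fin (d + 1) → ℤ) → MKer (d + 1) (Fib d)} {B : ℝ}
    (hS₁ : ∀ κ' u x z a b, |S₁ κ' u x z a b| ≤ B) (hS₂ : ∀ κ' u x z a b, |S₂ κ' u x z a b| ≤ B)
    (hM₁ : ∀ ρ w x z a b, |M₁ ρ w x z a b| ≤ B) (hM₂ : ∀ ρ w x z a b, |M₂ ρ w x z a b| ≤ B)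
    (ν : Fin (d + 1)) (y' : Fin (d + 1) → ℤ) (hD₁ : Loc (dM K N S₁ M₁ ν y')) (hD₂ : Loc (dM K N S₂ M₂ ν y')) :
    K2OfK K N (S₁ + S₂) (M₁ + M₂) ν y' = K2OfK K N S₁ M₁ ν y' + K2OfK K N S₂ M₂ ν y' := by
  rw [K2OfK_eq, K2OfK_eq, K2OfK_eq, dM_add_pair hK hS₁ hS₂ hM₁ hM₂, sandwich_add (spr_of_decays hK) hD₁ hD₂, neg_add]

/-! ## §3 The carrier's first-order part expands bilinearly over a sum of two pairs -/

/-- [folklore] **THE CARRIER's FIRST-ORDER PART IS BILINEAR IN THE PAIR**: with `D_ik := dM (K2OfK K N S_i M_i b′) N S_k M_k b`,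
`dM (K2OfK K N (S₁+S₂) (M₁+M₂) b′) N (S₁+S₂) (M₁+M₂) b = D₁₁ + D₁₂ + D₂₁ + D₂₂` (decaying `K`, bounded tables, localised `dM K N S_i M_i b′`). -/
theorem dM_K2OfK_add_pair {K : MKer (d + 1) (Fib d)} (hK : ∃ δ C : ℝ, 0 < δ ∧ 0 ≤ C ∧ Decays K C δ)
    {S₁ S₂ M₁ M₂ : Fin (d + 1) → (Fin (d + 1) → ℤ) → MKer (d + 1) (Fib d)} {B : ℝ}
    (hS₁ : ∀ κ' u x z a b, |S₁ κ' u x z a b| ≤ B) (hS₂ : ∀ κ' u x z a b, |S₂ κ' u x z a b| ≤ B)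
    (hM₁ : ∀ ρ w x z a b, |M₁ ρ w x z a b| ≤ B) (hM₂ : ∀ ρ w x z a b, |M₂ ρ w x z a b| ≤ B)
    (μ : Fin (d + 1)) (y : Fin (d + 1) → ℤ) (ν : Fin (d + 1)) (y' : Fin (d + 1) → ℤ)
    (hD₁ : Loc (dM K N S₁ M₁ ν y')) (hD₂ : Loc (dM K N S₂ M₂ ν y')) :
    dM (K2OfK K N (S₁ + S₂) (M₁ + M₂) ν y') N (S₁ + S₂) (M₁ + M₂) μ y =
      dM (K2OfK K N S₁ M₁ ν y') N S₁ M₁ μ y + dM (K2OfK K N S₁ M₁ ν y') N S₂ M₂ μ y +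
        dM (K2OfK K N S₂ M₂ ν y') N S₁ M₁ μ y + dM (K2OfK K N S₂ M₂ ν y') N S₂ M₂ μ y := by
  have hKs : Spr K := spr_of_decays hK
  have hE₁ : ∃ δ C : ℝ, 0 < δ ∧ 0 ≤ C ∧ Decays (K2OfK K N S₁ M₁ ν y') C δ := decays_of_loc (loc_K2OfK hKs ν y' hD₁)
  have hE₂ : ∃ δ C : ℝ, 0 < δ ∧ 0 ≤ C ∧ Decays (K2OfK K N S₂ M₂ ν y') C δ := decays_of_loc (loc_K2OfK hKs ν y' hD₂)
  have h12S : ∀ κ' u x z a b, |(S₁ + S₂) κ' u x z a b| ≤ B + B := fun κ' u x z a b => by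
    simp only [Pi.add_apply]; exact (abs_add_le _ _).trans (add_le_add (hS₁ κ' u x z a b) (hS₂ κ' u x z a b))
  have h12M : ∀ ρ w x z a b, |(M₁ + M₂) ρ w x z a b| ≤ B + B := fun ρ w x z a b => by
    simp only [Pi.add_apply]; exact (abs_add_le _ _).trans (add_le_add (hM₁ ρ w x z a b) (hM₂ ρ w x z a b))
  rw [K2OfK_add_pair hK hS₁ hS₂ hM₁ hM₂ ν y' hD₁ hD₂, dM_add_kernel hE₁ hE₂ h12S h12M,
    dM_add_pair hE₁ hS₁ hS₂ hM₁ hM₂, dM_add_pair hE₂ hS₁ hS₂ hM₁ hM₂]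
  abel

/-! ## §4 The `W`-free part of the third-order read-out expands into the four mixed products -/

/-- [folklore] A product `K ∘ D ∘ E` with `K` spread and `D, E` localised is additive in `D` and in `E` (tame compositions). -/
theorem prod_add_add {K D₁ D₂ E₁ E₂ : MKer (d + 1) (Fib d)} (hKs : Spr K) (hD₁ : Loc D₁) (hD₂ : Loc D₂) (hE₁ : Loc E₁) (hE₂ : Loc E₂) :
    comp (comp K (D₁ + D₂)) (E₁ + E₂) =
      comp (comp K D₁) E₁ + comp (comp K D₁) E₂ + comp (comp K D₂) E₁ + comp (comp K D₂) E₂ := by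
  rw [comp_add_right_tame hKs.tame hD₁.tame hD₂.tame, comp_add_left_tame (hKs.comp_loc hD₁).tame (hKs.comp_loc hD₂).tame (hE₁.add hE₂).tame,
    comp_add_right_tame (hKs.comp_loc hD₁).tame hE₁.tame hE₂.tame, comp_add_right_tame (hKs.comp_loc hD₂).tame hE₁.tame hE₂.tame]
  abel

/-- [folklore] **THE `W`-FREE PART OF `K3OfK` IS BILINEAR IN THE PAIR**: over a sum of two pairs, `K3OfK K N (S₁+S₂) (M₁+M₂) W b b′ + K∘W b b′∘K` (the `W`-free part) is the sum
over `i, k ∈ {1,2}` of `−K∘dM_i b∘K2_k b′ − K∘dM_i b′∘K2_k b` with `dM_i := dM K N S_i M_i`, `K2_k := K2OfK K N S_k M_k` (decaying `K`, bounded tables, localised `dM_i` at both bonds). -/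
theorem K3OfK_pure_add_pair {K : MKer (d + 1) (Fib d)} (hK : ∃ δ C : ℝ, 0 < δ ∧ 0 ≤ C ∧ Decays K C δ)
    {S₁ S₂ M₁ M₂ : Fin (d + 1) → (Fin (d + 1) → ℤ) → MKer (d + 1) (Fib d)} {B : ℝ}
    (hS₁ : ∀ κ' u x z a b, |S₁ κ' u x z a b| ≤ B) (hS₂ : ∀ κ' u x z a b, |S₂ κ' u x z a b| ≤ B)
    (hM₁ : ∀ ρ w x z a b, |M₁ ρ w x z a b| ≤ B) (hM₂ : ∀ ρ w x z a b, |M₂ ρ w x z a b| ≤ B)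
    (W : Fin (d + 1) → (Fin (d + 1) → ℤ) → Fin (d + 1) → (Fin (d + 1) → ℤ) → MKer (d + 1) (Fib d))
    (μ : Fin (d + 1)) (y : Fin (d + 1) → ℤ) (ν : Fin (d + 1)) (y' : Fin (d + 1) → ℤ)
    (hD₁ : Loc (dM K N S₁ M₁ μ y)) (hD₂ : Loc (dM K N S₂ M₂ μ y)) (hD₁' : Loc (dM K N S₁ M₁ ν y')) (hD₂' : Loc (dM K N S₂ M₂ ν y')) :
    K3OfK K N (S₁ + S₂) (M₁ + M₂) W μ y ν y' + comp (comp K (W μ y ν y')) K =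
      -(comp (comp K (dM K N S₁ M₁ μ y)) (K2OfK K N S₁ M₁ ν y') + comp (comp K (dM K N S₁ M₁ μ y)) (K2OfK K N S₂ M₂ ν y') +
          comp (comp K (dM K N S₂ M₂ μ y)) (K2OfK K N S₁ M₁ ν y') + comp (comp K (dM K N S₂ M₂ μ y)) (K2OfK K N S₂ M₂ ν y')) -
        (comp (comp K (dM K N S₁ M₁ ν y')) (K2OfK K N S₁ M₁ μ y) + comp (comp K (dM K N S₁ M₁ ν y')) (K2OfK K N S₂ M₂ μ y) +
          comp (comp K (dM K N S₂ M₂ ν y')) (K2OfK K N S₁ M₁ μ y) + comp (comp K (dM K N S₂ M₂ ν y')) (K2OfK K N S₂ M₂ μ y)) := by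
  have hKs : Spr K := spr_of_decays hK
  have hE₁ : Loc (K2OfK K N S₁ M₁ μ y) := loc_K2OfK hKs μ y hD₁
  have hE₂ : Loc (K2OfK K N S₂ M₂ μ y) := loc_K2OfK hKs μ y hD₂
  have hE₁' : Loc (K2OfK K N S₁ M₁ ν y') := loc_K2OfK hKs ν y' hD₁'
  have hE₂' : Loc (K2OfK K N S₂ M₂ ν y') := loc_K2OfK hKs ν y' hD₂'
  funext x z a b
  simp only [BalabanStepW2.K3OfK, Pi.add_apply, Pi.sub_apply, Pi.neg_apply]
  rw [dM_add_pair hK hS₁ hS₂ hM₁ hM₂ μ y, dM_add_pair hK hS₁ hS₂ hM₁ hM₂ ν y', K2OfK_add_pair hK hS₁ hS₂ hM₁ hM₂ ν y' hD₁' hD₂',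
    K2OfK_add_pair hK hS₁ hS₂ hM₁ hM₂ μ y hD₁ hD₂, prod_add_add hKs hD₁ hD₂ hE₁' hE₂', prod_add_add hKs hD₁' hD₂' hE₁ hE₂]
  simp only [Pi.add_apply]
  ring


/-! ## §5 Certificates: bounds and localisations from the tables' `LocStencil` ∕ `VertexFamily` certificates -/

/-- [folklore] A certified local field table is uniformly bounded (`ChartConjugationReflection.abs_le_of_locStencil`, packaged with an existential certificate). -/
theorem bdd_of_locCert {S : Fin (d + 1) → (Fin (d + 1) → ℤ) → MKer (d + 1) (Fib d)} (hS : ∃ C δ : ℝ, 0 < δ ∧ LocStencil S C δ) :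
    ∃ B : ℝ, 0 ≤ B ∧ ∀ κ' u x z a b, |S κ' u x z a b| ≤ B := by
  obtain ⟨C, δ, hδ, hS⟩ := hS
  exact ⟨C, (abs_nonneg _).trans (abs_le_of_locStencil hS hδ.le 0 0 0 0 (Sum.inl 0) (Sum.inl 0)), fun κ' u x z a b => abs_le_of_locStencil hS hδ.le κ' u x z a b⟩

omit [NeZero N] in
/-- [folklore] A certified coarse-local multiplier table is uniformly bounded (`KernelWard.bdd_of_biLoc`). -/
theorem bdd_of_vfCert {M : Fin (d + 1) → (Fin (d + 1) → ℤ) → MKer (d + 1) (Fib d)} (hM : ∃ C δ : ℝ, 0 < δ ∧ VertexFamily M N C δ) :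
    ∃ B : ℝ, 0 ≤ B ∧ ∀ ρ w x z a b, |M ρ w x z a b| ≤ B := by
  obtain ⟨C, δ, hδ, hM⟩ := hM
  exact ⟨C, (abs_nonneg _).trans (KernelWard.bdd_of_biLoc (hM 0 0) hδ.le 0 0 (Sum.inl 0) (Sum.inl 0)), fun ρ w x z a b => KernelWard.bdd_of_biLoc (hM ρ w) hδ.le x z a b⟩

/-- [folklore] **THE `Loc` CERTIFICATE OF THE OPERATOR DERIVATIVE FROM THE TABLES' CERTIFICATES** (common rate = the least of the three; `SecondOrderTransport.loc_dM`). -/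
theorem loc_dM_of_certs {K : MKer (d + 1) (Fib d)} (hK : ∃ δ C : ℝ, 0 < δ ∧ 0 ≤ C ∧ Decays K C δ)
    {S M : Fin (d + 1) → (Fin (d + 1) → ℤ) → MKer (d + 1) (Fib d)} (hS : ∃ C δ : ℝ, 0 < δ ∧ LocStencil S C δ) (hM : ∃ C δ : ℝ, 0 < δ ∧ VertexFamily M N C δ)
    (ν : Fin (d + 1)) (y' : Fin (d + 1) → ℤ) : Loc (dM K N S M ν y') := by
  obtain ⟨δK, CK, hδK, hCK, hKd⟩ := hK
  obtain ⟨Cs, δs, hδs, hSl⟩ := hS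
  obtain ⟨CM, δM, hδM, hMl⟩ := hM
  have hCs : 0 ≤ Cs := (abs_nonneg _).trans (abs_le_of_locStencil hSl hδs.le 0 0 0 0 (Sum.inl 0) (Sum.inl 0))
  have hCM : 0 ≤ CM := (abs_nonneg _).trans (KernelWard.bdd_of_biLoc (hMl 0 0) hδM.le 0 0 (Sum.inl 0) (Sum.inl 0))
  set m : ℝ := min δK (min δs δM) with hm
  have hm0 : 0 < m := lt_min hδK (lt_min hδs hδM)
  exact loc_dM hKd hCK (BalabanStepJets.locStencil_mono hSl hCs ((min_le_right _ _).trans (min_le_left _ _)))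
    (fun ρ w => biLoc_mono (hMl ρ w) hCM ((min_le_right _ _).trans (min_le_right _ _))) hm0 (min_le_left _ _) ν y'

/-- [folklore] The derivative of the inverse DECAYS for certified tables (`loc_K2OfK` + `decays_of_loc`). -/
theorem decays_K2OfK_of_certs {K : MKer (d + 1) (Fib d)} (hK : ∃ δ C : ℝ, 0 < δ ∧ 0 ≤ C ∧ Decays K C δ)
    {S M : Fin (d + 1) → (Fin (d + 1) → ℤ) → MKer (d + 1) (Fib d)} (hS : ∃ C δ : ℝ, 0 < δ ∧ LocStencil S C δ) (hM : ∃ C δ : ℝ, 0 < δ ∧ VertexFamily M N C δ)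
    (ν : Fin (d + 1)) (y' : Fin (d + 1) → ℤ) : ∃ δ C : ℝ, 0 < δ ∧ 0 ≤ C ∧ Decays (K2OfK K N S M ν y') C δ :=
  decays_of_loc (loc_K2OfK (spr_of_decays hK) ν y' (loc_dM_of_certs hK hS hM ν y'))

omit [NeZero N] in
/-- [folklore] The zero field table and the zero multiplier table are certified (constant `0`, any rate). -/
theorem certs_zero : (∃ C δ : ℝ, 0 < δ ∧ LocStencil (fun (_ : Fin (d + 1)) (_ : Fin (d + 1) → ℤ) => (0 : MKer (d + 1) (Fib d))) C δ) ∧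
    (∃ C δ : ℝ, 0 < δ ∧ VertexFamily (fun (_ : Fin (d + 1)) (_ : Fin (d + 1) → ℤ) => (0 : MKer (d + 1) (Fib d))) N C δ) :=
  ⟨⟨0, 1, one_pos, fun _ _ x z a b => by simp⟩, ⟨0, 1, one_pos, fun _ _ x z a b => by simp⟩⟩

/-! ## §6 THE FIRST-ORDER SOURCE ALONG A QUADRATIC PAIR PATH `t ↦ (t²A + tB, t²P + tQ)` IS A QUARTIC IN `t` WITHOUT CONSTANT-FREE LINEAR TERM -/

section Path

variable {K : MKer (d + 1) (Fib d)} {A B P Q : Fin (d + 1) → (Fin (d + 1) → ℤ) → MKer (d + 1) (Fib d)}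

/-- [folklore] The weighted pair: `dM K N (s•S) (s•M) b = s • dM K N S M b` (family form over this file's imports: `SecondOrderTransport.vertexOfK_smul_family ∕ vertexOfM_smul_family`). -/
private theorem dM_smul_pair (K : MKer (d + 1) (Fib d)) (s : ℝ) (S M : Fin (d + 1) → (Fin (d + 1) → ℤ) → MKer (d + 1) (Fib d)) (μ : Fin (d + 1)) (y : Fin (d + 1) → ℤ) :
    dM K N (fun κ u => s • S κ u) (fun ρ w => s • M ρ w) μ y = s • dM K N S M μ y := by
  unfold SecondOrderResponse.dM
  rw [vertexOfK_smul_family K s S μ y, vertexOfM_smul_family (N := N) K s M μ y, smul_add]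

/-- [folklore] The weighted pair in the derivative of the inverse: `K2OfK K N (s•S) (s•M) b′ = s • K2OfK K N S M b′`. -/
private theorem K2OfK_smul_pair (K : MKer (d + 1) (Fib d)) (s : ℝ) (S M : Fin (d + 1) → (Fin (d + 1) → ℤ) → MKer (d + 1) (Fib d)) (ν : Fin (d + 1)) (y' : Fin (d + 1) → ℤ) :
    K2OfK K N (fun κ u => s • S κ u) (fun ρ w => s • M ρ w) ν y' = s • K2OfK K N S M ν y' := by
  rw [K2OfK_eq, K2OfK_eq, dM_smul_pair, KernelReflection.comp_smul_right, KernelReflection.comp_smul_left, smul_neg]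

/-- [folklore] Entrywise bound of a member of the path `t²A + tB` by `(t² + |t|)·Bt`. -/
private theorem abs_path_le {X Y : Fin (d + 1) → (Fin (d + 1) → ℤ) → MKer (d + 1) (Fib d)} {Bt : ℝ} (hX : ∀ κ u x z a b, |X κ u x z a b| ≤ Bt) (hY : ∀ κ u x z a b, |Y κ u x z a b| ≤ Bt)
    (t : ℝ) (κ : Fin (d + 1)) (u x z : Fin (d + 1) → ℤ) (a b : Fib d) : |(t ^ 2 • X κ u + t • Y κ u) x z a b| ≤ (t ^ 2 + |t|) * Bt := by
  simp only [Pi.add_apply, Pi.smul_apply, smul_eq_mul]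
  refine (abs_add_le _ _).trans ?_
  rw [abs_mul, abs_mul, abs_pow, sq_abs, add_mul]
  exact add_le_add (mul_le_mul_of_nonneg_left (hX κ u x z a b) (sq_nonneg t)) (mul_le_mul_of_nonneg_left (hY κ u x z a b) (abs_nonneg t))

/-- [folklore] Entrywise bound of a weighted table `s•X` by `|s|·Bt`. -/
private theorem abs_smul_le {X : Fin (d + 1) → (Fin (d + 1) → ℤ) → MKer (d + 1) (Fib d)} {Bt : ℝ} (hX : ∀ κ u x z a b, |X κ u x z a b| ≤ Bt)
    (s : ℝ) (κ : Fin (d + 1)) (u x z : Fin (d + 1) → ℤ) (a b : Fib d) : |(s • X κ u) x z a b| ≤ |s| * Bt := by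
  simp only [Pi.smul_apply, smul_eq_mul, abs_mul]
  exact mul_le_mul_of_nonneg_left (hX κ u x z a b) (abs_nonneg s)

/-- [folklore] **THE OPERATOR DERIVATIVE ALONG THE PATH**: `dM K N (t²A + tB) (t²P + tQ) b = t² • dM K N A P b + t • dM K N B Q b` (decaying `K`, bounded tables). -/
theorem dM_path (hK : ∃ δ C : ℝ, 0 < δ ∧ 0 ≤ C ∧ Decays K C δ) {Bt : ℝ} (hA : ∀ κ u x z a b, |A κ u x z a b| ≤ Bt) (hB : ∀ κ u x z a b, |B κ u x z a b| ≤ Bt)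
    (hP : ∀ ρ w x z a b, |P ρ w x z a b| ≤ Bt) (hQ : ∀ ρ w x z a b, |Q ρ w x z a b| ≤ Bt) (t : ℝ) (μ : Fin (d + 1)) (y : Fin (d + 1) → ℤ) :
    dM K N (fun κ u => t ^ 2 • A κ u + t • B κ u) (fun ρ w => t ^ 2 • P ρ w + t • Q ρ w) μ y = t ^ 2 • dM K N A P μ y + t • dM K N B Q μ y := by
  have hBt : 0 ≤ Bt := (abs_nonneg _).trans (hA 0 0 0 0 (Sum.inl 0) (Sum.inl 0))
  have h1 : ∀ κ u x z a b, |(fun κ u => t ^ 2 • A κ u) κ u x z a b| ≤ (t ^ 2 + |t|) * Bt := fun κ u x z a b =>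
    (abs_smul_le hA _ κ u x z a b).trans (by rw [abs_pow, sq_abs]; nlinarith [abs_nonneg t])
  have h2 : ∀ κ u x z a b, |(fun κ u => t • B κ u) κ u x z a b| ≤ (t ^ 2 + |t|) * Bt := fun κ u x z a b =>
    (abs_smul_le hB _ κ u x z a b).trans (by nlinarith [abs_nonneg t, sq_nonneg t])
  have h3 : ∀ ρ w x z a b, |(fun ρ w => t ^ 2 • P ρ w) ρ w x z a b| ≤ (t ^ 2 + |t|) * Bt := fun ρ w x z a b =>
    (abs_smul_le hP _ ρ w x z a b).trans (by rw [abs_pow, sq_abs]; nlinarith [abs_nonneg t])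
  have h4 : ∀ ρ w x z a b, |(fun ρ w => t • Q ρ w) ρ w x z a b| ≤ (t ^ 2 + |t|) * Bt := fun ρ w x z a b =>
    (abs_smul_le hQ _ ρ w x z a b).trans (by nlinarith [abs_nonneg t, sq_nonneg t])
  have e := dM_add_pair (N := N) hK h1 h2 h3 h4 μ y
  rw [dM_smul_pair, dM_smul_pair] at e
  exact e

omit [NeZero N] in
/-- [folklore] A common uniform bound for four certified tables. -/
theorem common_bound (hA : ∃ C δ : ℝ, 0 < δ ∧ LocStencil A C δ) (hB : ∃ C δ : ℝ, 0 < δ ∧ LocStencil B C δ)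
    (hP : ∃ C δ : ℝ, 0 < δ ∧ VertexFamily P N C δ) (hQ : ∃ C δ : ℝ, 0 < δ ∧ VertexFamily Q N C δ) :
    ∃ Bt : ℝ, (∀ κ u x z a b, |A κ u x z a b| ≤ Bt) ∧ (∀ κ u x z a b, |B κ u x z a b| ≤ Bt) ∧ (∀ ρ w x z a b, |P ρ w x z a b| ≤ Bt) ∧ (∀ ρ w x z a b, |Q ρ w x z a b| ≤ Bt) := by
  obtain ⟨B₁, h₁, hA⟩ := bdd_of_locCert hA
  obtain ⟨B₂, h₂, hB⟩ := bdd_of_locCert hB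
  obtain ⟨B₃, h₃, hP⟩ := bdd_of_vfCert (N := N) hP
  obtain ⟨B₄, h₄, hQ⟩ := bdd_of_vfCert (N := N) hQ
  exact ⟨B₁ + B₂ + B₃ + B₄, fun κ u x z a b => (hA κ u x z a b).trans (by linarith), fun κ u x z a b => (hB κ u x z a b).trans (by linarith),
    fun ρ w x z a b => (hP ρ w x z a b).trans (by linarith), fun ρ w x z a b => (hQ ρ w x z a b).trans (by linarith)⟩

/-- [folklore] `dM_path` for certified tables. -/
theorem dM_path' (hK : ∃ δ C : ℝ, 0 < δ ∧ 0 ≤ C ∧ Decays K C δ) (hA : ∃ C δ : ℝ, 0 < δ ∧ LocStencil A C δ) (hB : ∃ C δ : ℝ, 0 < δ ∧ LocStencil B C δ)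
    (hP : ∃ C δ : ℝ, 0 < δ ∧ VertexFamily P N C δ) (hQ : ∃ C δ : ℝ, 0 < δ ∧ VertexFamily Q N C δ) (t : ℝ) (μ : Fin (d + 1)) (y : Fin (d + 1) → ℤ) :
    dM K N (fun κ u => t ^ 2 • A κ u + t • B κ u) (fun ρ w => t ^ 2 • P ρ w + t • Q ρ w) μ y = t ^ 2 • dM K N A P μ y + t • dM K N B Q μ y := by
  obtain ⟨Bt, hA', hB', hP', hQ'⟩ := common_bound (N := N) hA hB hP hQ
  exact dM_path hK hA' hB' hP' hQ' t μ y

/-- [folklore] **THE DERIVATIVE OF THE INVERSE ALONG THE PATH**: `K2OfK K N (t²A + tB) (t²P + tQ) b′ = t² • K2OfK K N A P b′ + t • K2OfK K N B Q b′` (certified tables). -/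
theorem K2OfK_path (hK : ∃ δ C : ℝ, 0 < δ ∧ 0 ≤ C ∧ Decays K C δ) (hA : ∃ C δ : ℝ, 0 < δ ∧ LocStencil A C δ) (hB : ∃ C δ : ℝ, 0 < δ ∧ LocStencil B C δ)
    (hP : ∃ C δ : ℝ, 0 < δ ∧ VertexFamily P N C δ) (hQ : ∃ C δ : ℝ, 0 < δ ∧ VertexFamily Q N C δ) (t : ℝ) (ν : Fin (d + 1)) (y' : Fin (d + 1) → ℤ) :
    K2OfK K N (fun κ u => t ^ 2 • A κ u + t • B κ u) (fun ρ w => t ^ 2 • P ρ w + t • Q ρ w) ν y' = t ^ 2 • K2OfK K N A P ν y' + t • K2OfK K N B Q ν y' := by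
  rw [K2OfK_eq, K2OfK_eq, K2OfK_eq, dM_path' hK hA hB hP hQ t ν y',
    sandwich_add (spr_of_decays hK) ((loc_dM_of_certs hK hA hP ν y').smul _) ((loc_dM_of_certs hK hB hQ ν y').smul _),
    KernelReflection.comp_smul_right, KernelReflection.comp_smul_left, KernelReflection.comp_smul_right, KernelReflection.comp_smul_left, neg_add, smul_neg, smul_neg]

/-- [folklore] **THE CARRIER's FIRST-ORDER PART ALONG THE PATH IS A QUARTIC WITHOUT TERMS OF DEGREE `< 2`**: with `D_ac := dM (K2OfK K N a b′) N c b` over the two pairs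
`a, c ∈ {(A,P), (B,Q)}`, `dM (K2OfK K N x(t) b′) N x(t) b = t⁴ • D_{(A,P)(A,P)} + t³ • (D_{(A,P)(B,Q)} + D_{(B,Q)(A,P)}) + t² • D_{(B,Q)(B,Q)}`, `x(t) = (t²A + tB, t²P + tQ)`. -/
theorem dM_K2OfK_path (hK : ∃ δ C : ℝ, 0 < δ ∧ 0 ≤ C ∧ Decays K C δ) (hA : ∃ C δ : ℝ, 0 < δ ∧ LocStencil A C δ) (hB : ∃ C δ : ℝ, 0 < δ ∧ LocStencil B C δ)
    (hP : ∃ C δ : ℝ, 0 < δ ∧ VertexFamily P N C δ) (hQ : ∃ C δ : ℝ, 0 < δ ∧ VertexFamily Q N C δ) (t : ℝ) (μ : Fin (d + 1)) (y : Fin (d + 1) → ℤ) (ν : Fin (d + 1)) (y' : Fin (d + 1) → ℤ) :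
    dM (K2OfK K N (fun κ u => t ^ 2 • A κ u + t • B κ u) (fun ρ w => t ^ 2 • P ρ w + t • Q ρ w) ν y') N (fun κ u => t ^ 2 • A κ u + t • B κ u) (fun ρ w => t ^ 2 • P ρ w + t • Q ρ w) μ y =
      t ^ 4 • dM (K2OfK K N A P ν y') N A P μ y + t ^ 3 • (dM (K2OfK K N A P ν y') N B Q μ y + dM (K2OfK K N B Q ν y') N A P μ y) +
        t ^ 2 • dM (K2OfK K N B Q ν y') N B Q μ y := by
  obtain ⟨Bt, hA', hB', hP', hQ'⟩ := common_bound (N := N) hA hB hP hQ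
  have hEa := decays_K2OfK_of_certs hK hA hP ν y'
  have hEb := decays_K2OfK_of_certs hK hB hQ ν y'
  have hEa' : ∃ δ C : ℝ, 0 < δ ∧ 0 ≤ C ∧ Decays (t ^ 2 • K2OfK K N A P ν y') C δ :=
    decays_of_loc ((loc_K2OfK (spr_of_decays hK) ν y' (loc_dM_of_certs hK hA hP ν y')).smul _)
  have hEb' : ∃ δ C : ℝ, 0 < δ ∧ 0 ≤ C ∧ Decays (t • K2OfK K N B Q ν y') C δ :=
    decays_of_loc ((loc_K2OfK (spr_of_decays hK) ν y' (loc_dM_of_certs hK hB hQ ν y')).smul _)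
  rw [K2OfK_path hK hA hB hP hQ t ν y', dM_add_kernel hEa' hEb' (abs_path_le hA' hB' t) (abs_path_le hP' hQ' t), dM_smul_kernel, dM_smul_kernel,
    dM_path hEa hA' hB' hP' hQ' t μ y, dM_path hEb hA' hB' hP' hQ' t μ y]
  funext x z a b
  simp only [Pi.add_apply, Pi.smul_apply, smul_eq_mul]
  ring

/-- [folklore] **THE `W`-FREE PART OF THE THIRD-ORDER READ-OUT ALONG THE PATH IS A QUARTIC WITHOUT TERMS OF DEGREE `< 2`**: with `D_a := dM K N a`, `E_a := K2OfK K N a` (`a ∈ {(A,P),(B,Q)}`),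
`K3OfK K N x(t) W b b′ + K∘W b b′∘K = −[t⁴ • (K∘D_A b∘E_A b′ + K∘D_A b′∘E_A b) + t³ • (K∘D_A b∘E_B b′ + K∘D_B b∘E_A b′ + K∘D_A b′∘E_B b + K∘D_B b′∘E_A b) + t² • (K∘D_B b∘E_B b′ + K∘D_B b′∘E_B b)]`. -/
theorem K3OfK_pure_path (hK : ∃ δ C : ℝ, 0 < δ ∧ 0 ≤ C ∧ Decays K C δ) (hA : ∃ C δ : ℝ, 0 < δ ∧ LocStencil A C δ) (hB : ∃ C δ : ℝ, 0 < δ ∧ LocStencil B C δ)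
    (hP : ∃ C δ : ℝ, 0 < δ ∧ VertexFamily P N C δ) (hQ : ∃ C δ : ℝ, 0 < δ ∧ VertexFamily Q N C δ)
    (W : Fin (d + 1) → (Fin (d + 1) → ℤ) → Fin (d + 1) → (Fin (d + 1) → ℤ) → MKer (d + 1) (Fib d)) (t : ℝ) (μ : Fin (d + 1)) (y : Fin (d + 1) → ℤ) (ν : Fin (d + 1)) (y' : Fin (d + 1) → ℤ) :
    K3OfK K N (fun κ u => t ^ 2 • A κ u + t • B κ u) (fun ρ w => t ^ 2 • P ρ w + t • Q ρ w) W μ y ν y' + comp (comp K (W μ y ν y')) K =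
      -(t ^ 4 • (comp (comp K (dM K N A P μ y)) (K2OfK K N A P ν y') + comp (comp K (dM K N A P ν y')) (K2OfK K N A P μ y)) +
          t ^ 3 • (comp (comp K (dM K N A P μ y)) (K2OfK K N B Q ν y') + comp (comp K (dM K N B Q μ y)) (K2OfK K N A P ν y') +
            (comp (comp K (dM K N A P ν y')) (K2OfK K N B Q μ y) + comp (comp K (dM K N B Q ν y')) (K2OfK K N A P μ y))) +
        t ^ 2 • (comp (comp K (dM K N B Q μ y)) (K2OfK K N B Q ν y') + comp (comp K (dM K N B Q ν y')) (K2OfK K N B Q μ y))) := by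
  have hKs : Spr K := spr_of_decays hK
  have hDa := loc_dM_of_certs hK hA hP
  have hDb := loc_dM_of_certs hK hB hQ
  have hEa : ∀ c z, Loc (K2OfK K N A P c z) := fun c z => loc_K2OfK hKs c z (hDa c z)
  have hEb : ∀ c z, Loc (K2OfK K N B Q c z) := fun c z => loc_K2OfK hKs c z (hDb c z)
  have hprod : ∀ (c : Fin (d + 1)) (z : Fin (d + 1) → ℤ) (c' : Fin (d + 1)) (z' : Fin (d + 1) → ℤ),
      comp (comp K (t ^ 2 • dM K N A P c z + t • dM K N B Q c z)) (t ^ 2 • K2OfK K N A P c' z' + t • K2OfK K N B Q c' z') =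
        (t ^ 2 * t ^ 2) • comp (comp K (dM K N A P c z)) (K2OfK K N A P c' z') + (t * t ^ 2) • comp (comp K (dM K N A P c z)) (K2OfK K N B Q c' z') +
          (t ^ 2 * t) • comp (comp K (dM K N B Q c z)) (K2OfK K N A P c' z') + (t * t) • comp (comp K (dM K N B Q c z)) (K2OfK K N B Q c' z') := by
    intro c z c' z'
    rw [prod_add_add hKs ((hDa c z).smul _) ((hDb c z).smul _) ((hEa c' z').smul _) ((hEb c' z').smul _)]
    simp only [KernelReflection.comp_smul_right, KernelReflection.comp_smul_left, smul_smul]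
  funext x z a b
  simp only [BalabanStepW2.K3OfK, Pi.add_apply, Pi.neg_apply, Pi.smul_apply, smul_eq_mul]
  rw [dM_path' hK hA hB hP hQ t μ y, dM_path' hK hA hB hP hQ t ν y', K2OfK_path hK hA hB hP hQ t μ y, K2OfK_path hK hA hB hP hQ t ν y', hprod, hprod]
  simp only [Pi.add_apply, Pi.smul_apply, smul_eq_mul]
  ring

/-- [folklore] **THE SYMMETRISED CARRIER ALONG THE PATH**: `W2SymOfK K N x(t) S₂ M₂ b b′ = W2SymOfK K N 0 0 S₂ M₂ b b′ + ½ • [t⁴ • (D_AA b b′ + D_AA b′ b) + t³ • (…) + t² • (D_BB b b′ + D_BB b′ b)]`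
— the bi-vertex and the mixed vertices do not see the first-order pair; at the zero pair the first-order part vanishes (`W2OfK_apply`, `dM_K2OfK_path` at `t` and at `t = 0`). -/
theorem W2SymOfK_path (hK : ∃ δ C : ℝ, 0 < δ ∧ 0 ≤ C ∧ Decays K C δ) (hA : ∃ C δ : ℝ, 0 < δ ∧ LocStencil A C δ) (hB : ∃ C δ : ℝ, 0 < δ ∧ LocStencil B C δ)
    (hP : ∃ C δ : ℝ, 0 < δ ∧ VertexFamily P N C δ) (hQ : ∃ C δ : ℝ, 0 < δ ∧ VertexFamily Q N C δ)
    (S₂ M₂ : Fin (d + 1) → (Fin (d + 1) → ℤ) → Fin (d + 1) → (Fin (d + 1) → ℤ) → MKer (d + 1) (Fib d)) (t : ℝ) (μ : Fin (d + 1)) (y : Fin (d + 1) → ℤ) (ν : Fin (d + 1)) (y' : Fin (d + 1) → ℤ) :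
    W2SymOfK K N (fun κ u => t ^ 2 • A κ u + t • B κ u) (fun ρ w => t ^ 2 • P ρ w + t • Q ρ w) S₂ M₂ μ y ν y' =
      W2SymOfK K N (fun _ _ => 0) (fun _ _ => 0) S₂ M₂ μ y ν y' +
        (1 / 2 : ℝ) • (t ^ 4 • (dM (K2OfK K N A P ν y') N A P μ y + dM (K2OfK K N A P μ y) N A P ν y') +
          t ^ 3 • (dM (K2OfK K N A P ν y') N B Q μ y + dM (K2OfK K N B Q ν y') N A P μ y + (dM (K2OfK K N A P μ y) N B Q ν y' + dM (K2OfK K N B Q μ y) N A P ν y')) +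
          t ^ 2 • (dM (K2OfK K N B Q ν y') N B Q μ y + dM (K2OfK K N B Q μ y) N B Q ν y')) := by
  have hz : ∀ (X : MKer (d + 1) (Fib d)) (c : Fin (d + 1)) (w : Fin (d + 1) → ℤ), dM X N (fun (_ : Fin (d + 1)) (_ : Fin (d + 1) → ℤ) => (0 : MKer (d + 1) (Fib d))) (fun _ _ => 0) c w = 0 := by
    intro X c w
    funext x z a b
    simp [SecondOrderResponse.dM, OneStepKernelFamily.vertexOfK, SecondOrderResponse.vertexOfM, OneStepResolventKernel.wsum, cwsum_apply]
  simp only [SecondOrderResponse.W2SymOfK, W2OfK_apply]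
  rw [dM_K2OfK_path hK hA hB hP hQ t μ y ν y', dM_K2OfK_path hK hA hB hP hQ t ν y' μ y, hz, hz]
  funext x z a b
  simp only [Pi.add_apply, Pi.smul_apply, Pi.zero_apply, smul_eq_mul]
  ring

end Path

end Summit.QuantumFields.BalabanUV.Gaps.D1PinnedFirstOrderBilinear

end
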